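import Mathlib.MeasureTheory.Integral.DivergenceTheorem
import Mathlib.Analysis.Calculus.ContDiff.Basic
import Mathlib.Analysis.Calculus.FDeriv.Prod
import Mathlib.Analysis.Calculus.Deriv.Prod
import Mathlib.Analysis.Calculus.Deriv.Comp
import Mathlib.Topology.MetricSpace.Pseudo.Lemmas
import HarnessLib

/-!
# K3L `LagrangianCarrierConstruction` (stmt-AnomalousDissipation-24913), line `birth`, stub `stub_flowsL`:
# calculus of the interaction picture (helper; `--supports stmt-AnomalousDissipation-24913`)

Summits-side helper file (everything proved; no definitions, no named facts). Fourth brick of the Lagrangian insertion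
`stub_flowsL`: the pieces of one-variable calculus through which the inductive step of the Lagrangian tower
`X_{m+1}(t, w) = X_m(t, w) ∘ Z_{m+1}(t, w)` (coarse flow after the window's Eulerian flow — the "interaction picture") is
verified:
* `hasDerivAt_comp_curve` — the chain rule for `t ↦ H(t, ζ(t))` when `(t, z) ↦ H(t, z)` is (jointly) differentiable at
  `(t, ζ t)`: the derivative is the partial time derivative plus `D_z H(t, ·)(ζ t) ζ'(t)`. Applied with `H` the coarse flow
  and `ζ` a fine trajectory it produces the pushed-forward ("frozen-in") fine velocity `DX · v ∘ X⁻¹`, i.e. exactly the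
  inserted level field of `LagrangianLatticeCarrier.IsInserted`;
* `integral_eq_sub_of_hasDerivAt_off_countable` — the integral form `disp(t) − disp(s) = ∫_s^t velocity` of a trajectory
  that is continuous and differentiable off a countable set of times (window resets, envelope corners), from Mathlib's
  divergence-theorem FTC; `intervalIntegrable_of_bounded_of_continuousAt_off_countable` supplies the integrability;
* `countable_of_isolated` — a set of reals each point of the line keeps at distance (every `x` has a ball meeting the set
  at most in `x`) is countable: the shape in which the break times of the tower arise.
Infrastructure for the construction side of route-1's rung leaf F-D1.A0 (a frontier formal rung); NOT a proof of anomalous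
dissipation.
-/

set_option linter.dupNamespace false

noncomputable section

namespace Summit.AnomalousDissipation.AnomalousDissipation.Theorems.SolenoidalFractalHomogenisation.LagrangianCarrierConstruction

open Set Function Filter Topology Metric MeasureTheory

section ChainRule

variable {V : Type*} [NormedAddCommGroup V] [NormedSpace ℝ V]

/-- **Chain rule along a curve for a jointly differentiable two-variable map.** If `(t, z) ↦ H t z` is differentiable at
`(t, ζ t)`, its partial time derivative there (at the frozen point `ζ t`) is `B`, and `ζ` has derivative `ζ'` at `t`, then
`τ ↦ H τ (ζ τ)` has derivative `B + D(H t)(ζ t) ζ'` at `t`. [folklore] -/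
theorem hasDerivAt_comp_curve {H : ℝ → V → V} {ζ : ℝ → V} {t : ℝ} {B ζ' : V}
    (hH : DifferentiableAt ℝ (fun p : ℝ × V => H p.1 p.2) (t, ζ t))
    (hHt : HasDerivAt (fun τ => H τ (ζ t)) B t) (hζ : HasDerivAt ζ ζ' t) :
    HasDerivAt (fun τ => H τ (ζ τ)) (B + fderiv ℝ (H t) (ζ t) ζ') t := by
  obtain ⟨L, hL⟩ : ∃ L : ℝ × V →L[ℝ] V, L = fderiv ℝ (fun p : ℝ × V => H p.1 p.2) (t, ζ t) := ⟨_, rfl⟩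
  have hΦd : HasFDerivAt (fun p : ℝ × V => H p.1 p.2) L (t, ζ t) := by rw [hL]; exact hH.hasFDerivAt
  -- the full derivative along the curve `τ ↦ (τ, ζ τ)`
  have hγ : HasDerivAt (fun τ => ((τ, ζ τ) : ℝ × V)) ((1 : ℝ), ζ') t := (hasDerivAt_id t).prodMk hζ
  have hcomp : HasDerivAt (fun τ => H τ (ζ τ)) (L ((1 : ℝ), ζ')) t := by
    have h := HasFDerivAt.comp_hasDerivAt t hΦd hγ
    exact h
  -- the partial time derivative is `L (1, 0)`
  have hγ₀ : HasDerivAt (fun τ => ((τ, ζ t) : ℝ × V)) ((1 : ℝ), (0 : V)) t :=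
    (hasDerivAt_id t).prodMk (hasDerivAt_const t (ζ t))
  have h1 : HasDerivAt (fun τ => H τ (ζ t)) (L ((1 : ℝ), (0 : V))) t := by
    have h := HasFDerivAt.comp_hasDerivAt t hΦd hγ₀
    exact h
  have hB : B = L ((1 : ℝ), (0 : V)) := hHt.unique h1
  -- the partial space derivative is `L ∘ inr`
  have h2 : HasFDerivAt (fun z => H t z) (L.comp (ContinuousLinearMap.inr ℝ ℝ V)) (ζ t) :=
    HasFDerivAt.comp (ζ t) hΦd (hasFDerivAt_prodMk_right t (ζ t))
  have hD : fderiv ℝ (H t) (ζ t) = L.comp (ContinuousLinearMap.inr ℝ ℝ V) := h2.fderiv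
  have hsplit : L ((1 : ℝ), ζ') = B + fderiv ℝ (H t) (ζ t) ζ' := by
    rw [hB, hD, ContinuousLinearMap.comp_apply, ContinuousLinearMap.inr_apply, ← map_add]
    congr 1
    simp
  rw [← hsplit]
  exact hcomp

/-- The same chain rule when the two-variable map is `C¹` at the point (the form in which joint smoothness of flows is
available). [folklore] -/
theorem hasDerivAt_comp_curve_of_contDiffAt {H : ℝ → V → V} {ζ : ℝ → V} {t : ℝ} {B ζ' : V} {n : WithTop ℕ∞}
    (hH : ContDiffAt ℝ n (fun p : ℝ × V => H p.1 p.2) (t, ζ t)) (hn : 1 ≤ n)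
    (hHt : HasDerivAt (fun τ => H τ (ζ t)) B t) (hζ : HasDerivAt ζ ζ' t) :
    HasDerivAt (fun τ => H τ (ζ τ)) (B + fderiv ℝ (H t) (ζ t) ζ') t :=
  hasDerivAt_comp_curve (hH.differentiableAt (by positivity)) hHt hζ

end ChainRule

section FTC

variable {V : Type*} [NormedAddCommGroup V] [NormedSpace ℝ V] [CompleteSpace V]

/-- **Integral form of a trajectory differentiable off a countable set of times**: if `F` is continuous, has derivative
`f t` at every `t ∉ D` with `D` countable, and `f` is interval integrable, then `∫_s^t f = F t − F s` for all `s, t`.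
[folklore] -/
theorem integral_eq_sub_of_hasDerivAt_off_countable {F f : ℝ → V} {D : Set ℝ} (hD : D.Countable)
    (hcont : Continuous F) (hderiv : ∀ t ∉ D, HasDerivAt F (f t) t)
    (hint : ∀ a b, IntervalIntegrable f volume a b) (s t : ℝ) :
    ∫ r in s..t, f r = F t - F s :=
  integral_eq_of_hasDerivAt_off_countable F f hD hcont.continuousOn (fun x hx => hderiv x hx.2) (hint s t)

omit [NormedSpace ℝ V] [CompleteSpace V] in
/-- A function on the line which is continuous at every point outside a countable set is a.e. strongly measurable.
[folklore] -/
theorem aestronglyMeasurable_of_continuousAt_off_countable {f : ℝ → V} {D : Set ℝ} (hD : D.Countable)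
    (hf : ∀ t ∉ D, ContinuousAt f t) : AEStronglyMeasurable f volume := by
  have hS : MeasurableSet Dᶜ := hD.measurableSet.compl
  have hcont : ContinuousOn f Dᶜ := fun t ht => (hf t ht).continuousWithinAt
  have h := hcont.aestronglyMeasurable (μ := volume) hS
  have hae : ∀ᵐ x ∂(volume : Measure ℝ), x ∈ Dᶜ := by
    have h0 : (volume : Measure ℝ) D = 0 := hD.measure_zero _
    filter_upwards [measure_eq_zero_iff_ae_notMem.1 h0] with x hx using hx
  rwa [Measure.restrict_eq_self_of_ae_mem hae] at h

omit [NormedSpace ℝ V] [CompleteSpace V] in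
/-- **Interval integrability** of a function bounded on bounded time sets and continuous off a countable set. [folklore] -/
theorem intervalIntegrable_of_bounded_of_continuousAt_off_countable {f : ℝ → V} {D : Set ℝ} (hD : D.Countable)
    (hf : ∀ t ∉ D, ContinuousAt f t) (hbdd : ∀ a b : ℝ, ∃ C, ∀ t ∈ Icc a b, ‖f t‖ ≤ C) (a b : ℝ) :
    IntervalIntegrable f volume a b := by
  have hmeas := aestronglyMeasurable_of_continuousAt_off_countable hD hf
  obtain ⟨C, hC⟩ := hbdd (min a b) (max a b)
  have hint : IntegrableOn f (Icc (min a b) (max a b)) volume := by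
    refine Measure.integrableOn_of_bounded (M := C) measure_Icc_lt_top.ne hmeas ?_
    rw [ae_restrict_iff' measurableSet_Icc]
    exact Eventually.of_forall fun t ht => hC t ht
  exact (hint.mono_set (by rw [uIcc]) ).intervalIntegrable

end FTC

section Countable

/-- **A set of reals which every point of the line isolates is countable**: if each `x : ℝ` has a ball around it meeting
`D` at most in `x` itself, then `D` is countable (on each compact `[−n, n]` a finite subcover leaves finitely many points).
[folklore] -/
theorem countable_of_isolated {D : Set ℝ} (h : ∀ x : ℝ, ∃ ε > 0, ∀ y ∈ D, dist y x < ε → y = x) : D.Countable := by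
  -- `D ∩ [-n, n]` is finite for every `n`
  have hfin : ∀ n : ℕ, (D ∩ Icc (-(n : ℝ)) n).Finite := by
    intro n
    choose ε hε hiso using h
    obtain ⟨T, hTsub, hTfin, hcover⟩ := (isCompact_Icc (a := -(n : ℝ)) (b := n)).elim_finite_subcover_image
      (b := univ) (c := fun x => ball x (ε x)) (fun x _ => isOpen_ball)
      (fun x hx => mem_iUnion₂.2 ⟨x, mem_univ x, mem_ball_self (hε x)⟩)
    refine (hTfin.subset ?_)
    rintro y ⟨hyD, hyI⟩
    obtain ⟨x, hxT, hyx⟩ := mem_iUnion₂.1 (hcover hyI)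
    have := hiso x y hyD (mem_ball.1 hyx)
    subst this
    exact hxT
  have hD : D = ⋃ n : ℕ, D ∩ Icc (-(n : ℝ)) n := by
    ext y
    simp only [mem_iUnion, mem_inter_iff, mem_Icc]
    constructor
    · intro hy
      obtain ⟨n, hn⟩ := exists_nat_ge |y|
      exact ⟨n, hy, by rw [abs_le] at hn; exact hn.1, by rw [abs_le] at hn; exact hn.2⟩
    · rintro ⟨n, hy, -, -⟩; exact hy
  rw [hD]
  exact countable_iUnion fun n => (hfin n).countable

/-- The complement form used for break times: if every point `r` has a punctured ball on which a property `P` holds, then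
the failure set `{t | ¬ P t}` is countable. [folklore] -/
theorem countable_setOf_not_of_eventually_punctured {P : ℝ → Prop}
    (h : ∀ r : ℝ, ∃ ε > 0, ∀ t, t ≠ r → dist t r < ε → P t) : {t | ¬ P t}.Countable := by
  refine countable_of_isolated fun x => ?_
  obtain ⟨ε, hε, hP⟩ := h x
  refine ⟨ε, hε, fun y hy hyx => ?_⟩
  by_contra hne
  exact hy (hP y hne hyx)

end Countable

end Summit.AnomalousDissipation.AnomalousDissipation.Theorems.SolenoidalFractalHomogenisation.LagrangianCarrierConstruction

end
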